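import Mathlib.Analysis.Convex.Function
import Summits.MatrixMultiplication.MatrixMultiplication.Theorems.EdgePencilSixthKronecker
import Summits.MatrixMultiplication.MatrixMultiplication.Theorems.EdgePencilSixthSymmetrisationExponent
import Summits.MatrixMultiplication.MatrixMultiplication.Theorems.EdgePencilPlusTwoCut
import HarnessLib

/-!
# The sixth-edge ladder is CONVEX: `χ((1−a)x + a y) ≤ (1−a)·χ(x) + a·χ(y)` on `[0,1]`,
# and what convexity does to the attacked leaf `TetraExcessZero`

Support kernel for `stmt-MatrixMultiplication-26697` (`TetraExcessZero : ω(K₄) ≤ ω(2,1,2)`, the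
attacked leaf of route `TetrahedronCarving`; lineage `decomp-mm-lens-6` «barrier-complement carving»,
generation 24). Companion of `EdgePencilSixthKronecker` (the finite law
`R₄(W_{N·M}^{(e₁·e₂)}) ≤ R₄(W_N^{(e₁)})·R₄(W_M^{(e₂)})`). No item is added or changed; no definition.

NOTATION. `χ(δ) = omegaSix F δ` (the exponent of `W_n^{(⌈n^δ⌉)}`, `EdgePencilSixthLadder`),
`ψ = ω(2,1,2) = χ(0)` (`omegaSix_zero`), `T = ω(K₄) = χ(1)` (`omegaSix_one`).

* §1 members of `sixAdmissibleExponents`: a bound for EVERY level `m ≥ 1`, and `β ≥ 0`.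
* §2 **convexity** (`omegaSix_convexOn : ConvexOn ℝ (Icc 0 1) χ`), by the Lotti–Romani template of
  `RectangularExponentProofs` (`m₁ = ⌈n^{1−a}⌉`, `m₂ = ⌈n^a⌉`, `n ≤ m₁m₂`,
  `⌈n^{(1−a)x+ay}⌉ ≤ ⌈m₁^x⌉⌈m₂^y⌉`, level monotonicity, bond monotonicity, Kronecker in the bond);
  the three-point form and the CHORD `χ(δ) ≤ (1−δ)ψ + δT`.
* §3 consequences for the leaf: a FLAT STEP is a rung (`χ(δ₂) ≤ χ(δ₁)`, `0 ≤ δ₁ < δ₂ ≤ 1` ⟹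
  `χ(δ₂) ≤ ψ`); growth at one interior point is the whole leaf
  (`ω(K₄) ≤ χ(δ₀)` for one `δ₀ < 1` ⟺ `TetraExcessZero`; in particular the registered stub
  `stub_growHalf : ω(K₄) ≤ χ(1/2)` of the «half-edge» skeleton is EQUIVALENT to the crux,
  `growHalf_iff_tetraExcessZero` — that skeleton is withdrawn by this generation).
* §4 the reshaped two-stub line «rung-and-chord»: `TetraExcessZero ⟺ SixRungPos ∧ MidTight` with
  `SixRungPos : ∃ δ > 0, χ(δ) ≤ ψ` (one rung above the bottom) and
  `MidTight : ψ + T ≤ 2·χ(1/2)` (the ladder touches its chord at the midpoint), and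
  `MidTight ⟺ NoKink : ∀ δ ∈ [0,1], (1−δ)ψ + δT ≤ χ(δ)` (a convex function touching its chord at an
  interior point is the chord); the weakest rung-side statement `FirstOrderFree : ∀ ε > 0 ∃ δ ∈ (0,1],
  χ(δ) ≤ ψ + εδ` with `SixRungPos ⟹ FirstOrderFree` and `FirstOrderFree ∧ NoKink ⟹ TetraExcessZero`.
  Both pieces are NEC (`ω = 2 ⟹` each). Their strict weakness (lawful `χ`-profiles in which exactly
  one of them holds and the leaf fails) is recorded in the lineage memo NODE-g24 §4.

References: Lotti–Romani 1983 §1–§2 (subadditivity and homogeneity ⟹ convexity of exponents)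
[LottiRomani1983]; Christandl–Vrana–Zuiddam, arXiv:1609.07476, §1.1, Prop. 1.1.16
[ChristandlVranaZuiddam2016]. No `sorry`, no new axiom, no instance, no notation, no definition.
-/

noncomputable section

set_option linter.dupNamespace false

open Filter Asymptotics Literature.Computability.AlgebraicComplexity
open Summit.MatrixMultiplication.MatrixMultiplication.Theorems.TetrahedronTensor
open Summit.MatrixMultiplication.MatrixMultiplication.Theorems.TetraDiagonal
open Summit.MatrixMultiplication.MatrixMultiplication.Theses.TetrahedronCarving

namespace Summit.MatrixMultiplication.MatrixMultiplication.Theorems.EdgePencil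

/-! ## §1 Members of the admissible sets -/

section Members

variable (F : Type) [Field F]

/-- Admissible exponents of the sixth-edge family are `≥ 0` (indeed `≥ 4`; grouping). [folklore] -/
theorem nonneg_of_mem_sixAdmissibleExponents {δ β : ℝ} (hβ : β ∈ sixAdmissibleExponents F δ) :
    0 ≤ β :=
  rectAdmissibleExponents_nonneg F (pencilAdmissibleExponents_subset_rect F le_rfl
    (sixAdmissibleExponents_subset_pencil_one F δ hβ))

/-- An admissible exponent bounds the rank at **every** level `m ≥ 1`:
`R₄(W_m^{(⌈m^δ⌉)}) ≤ C m^β` (finitely many exceptions absorbed into the constant). [folklore] -/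
theorem exists_bound_of_mem_sixAdmissibleExponents {δ β : ℝ}
    (hβ : β ∈ sixAdmissibleExponents F δ) :
    ∃ C : ℝ, 0 < C ∧ ∀ m : ℕ, 1 ≤ m →
      (tensorRankD (sixTetra F m (rectDim m δ)) : ℝ) ≤ C * (m : ℝ) ^ β := by
  obtain ⟨C, hC0, hC⟩ := bound_of_isBigO_nat_atTop hβ
  refine ⟨C, hC0, fun m hm => ?_⟩
  have hm0 : (0 : ℝ) < m := by exact_mod_cast hm
  have h : ‖(tensorRankD (sixTetra F m (rectDim m δ)) : ℝ)‖ ≤ C * ‖(m : ℝ) ^ β‖ :=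
    hC (Real.rpow_pos_of_pos hm0 β).ne'
  rwa [Real.norm_of_nonneg (Nat.cast_nonneg _), Real.norm_of_nonneg (Real.rpow_nonneg hm0.le _)] at h

end Members

/-! ## §2 Convexity -/

section Convexity

variable (F : Type) [Field F]

/-- **Convex combinations of admissible exponents are admissible**: if `β` is admissible for the
`x`-family and `γ` for the `y`-family (`x, y ∈ [0,1]`), then for weights `a, b ≥ 0`, `a + b = 1`,
`aβ + bγ` is admissible for the `(ax + by)`-family. With `m₁ = ⌈n^a⌉`, `m₂ = ⌈n^b⌉`:
`R₄(W_n^{(⌈n^{ax+by}⌉)}) ≤ R₄(W_{m₁m₂}^{(⌈n^{ax+by}⌉)}) ≤ R₄(W_{m₁m₂}^{(⌈m₁^x⌉⌈m₂^y⌉)})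
 ≤ R₄(W_{m₁}^{(⌈m₁^x⌉)})·R₄(W_{m₂}^{(⌈m₂^y⌉)}) ≤ C₁ m₁^β C₂ m₂^γ ≤ C₁C₂2^β2^γ n^{aβ+bγ}`
(level monotonicity, bond monotonicity, Kronecker in the bond). [cite: LottiRomani1983, §1 (p. 173)] -/
theorem convexComb_mem_sixAdmissibleExponents {x y : ℝ} (hx0 : 0 ≤ x) (hx1 : x ≤ 1)
    (hy0 : 0 ≤ y) (hy1 : y ≤ 1) {a b : ℝ} (ha : 0 ≤ a) (hb : 0 ≤ b) (hab : a + b = 1) {β γ : ℝ}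
    (hβ : β ∈ sixAdmissibleExponents F x) (hγ : γ ∈ sixAdmissibleExponents F y) :
    a * β + b * γ ∈ sixAdmissibleExponents F (a * x + b * y) := by
  obtain rfl : b = 1 - a := by linarith
  have hβ0 : 0 ≤ β := nonneg_of_mem_sixAdmissibleExponents F hβ
  have hγ0 : 0 ≤ γ := nonneg_of_mem_sixAdmissibleExponents F hγ
  obtain ⟨C₁, hC₁0, hC₁⟩ := exists_bound_of_mem_sixAdmissibleExponents F hβ
  obtain ⟨C₂, hC₂0, hC₂⟩ := exists_bound_of_mem_sixAdmissibleExponents F hγ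
  refine IsBigO.of_bound (C₁ * C₂ * ((2 : ℝ) ^ β * (2 : ℝ) ^ γ)) ?_
  filter_upwards [eventually_ge_atTop 1] with n hn
  have hn0 : (0 : ℝ) < n := by exact_mod_cast hn
  rw [Real.norm_of_nonneg (Nat.cast_nonneg _), Real.norm_of_nonneg (Real.rpow_nonneg hn0.le _)]
  -- `m₁ = ⌈n^a⌉ = rectDim n a`, `m₂ = ⌈n^{1-a}⌉ = rectDim n (1 - a)`
  have hm₁ : 1 ≤ rectDim n a := one_le_rectDim hn a
  have hm₂ : 1 ≤ rectDim n (1 - a) := one_le_rectDim hn (1 - a)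
  -- the bonds stay inside the levels: `⌈m^x⌉ ≤ m` for `x ≤ 1`
  have hb₁ : rectDim (rectDim n a) x ≤ rectDim n a :=
    calc rectDim (rectDim n a) x ≤ rectDim (rectDim n a) 1 := rectDim_mono hm₁ hx1
      _ = rectDim n a := rectDim_one _
  have hb₂ : rectDim (rectDim n (1 - a)) y ≤ rectDim n (1 - a) :=
    calc rectDim (rectDim n (1 - a)) y ≤ rectDim (rectDim n (1 - a)) 1 := rectDim_mono hm₂ hy1
      _ = rectDim n (1 - a) := rectDim_one _
  -- the rank estimate over `ℕ`: level padding, bond monotonicity, then the Kronecker product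
  have hnat : tensorRankD (sixTetra F n (rectDim n (a * x + (1 - a) * y))) ≤
      tensorRankD (sixTetra F (rectDim n a) (rectDim (rectDim n a) x)) *
        tensorRankD (sixTetra F (rectDim n (1 - a)) (rectDim (rectDim n (1 - a)) y)) :=
    calc tensorRankD (sixTetra F n (rectDim n (a * x + (1 - a) * y)))
        ≤ tensorRankD (sixTetra F (rectDim n a * rectDim n (1 - a))
            (rectDim n (a * x + (1 - a) * y))) :=
          tensorRankD_sixTetra_mono_level (le_rectDim_mul_rectDim n a) _
      _ ≤ tensorRankD (sixTetra F (rectDim n a * rectDim n (1 - a))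
            (rectDim (rectDim n a) x * rectDim (rectDim n (1 - a)) y)) :=
          tensorRankD_sixTetra_mono (rectDim_convexComb_le hn hx0 hy0 a (1 - a))
      _ ≤ _ := tensorRankD_sixTetra_kron_le hb₁ hb₂
  -- sizes: `m₁ ≤ 2 n^a`, `m₂ ≤ 2 n^{1-a}`
  have hm₁le : (rectDim n a : ℝ) ≤ 2 * (n : ℝ) ^ a := by
    simpa [max_eq_left ha] using rectDim_le hn a
  have hm₂le : (rectDim n (1 - a) : ℝ) ≤ 2 * (n : ℝ) ^ (1 - a) := by
    simpa [max_eq_left hb] using rectDim_le hn (1 - a)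
  have h₁ : (tensorRankD (sixTetra F (rectDim n a) (rectDim (rectDim n a) x)) : ℝ)
      ≤ C₁ * (2 * (n : ℝ) ^ a) ^ β :=
    (hC₁ _ hm₁).trans
      (mul_le_mul_of_nonneg_left (Real.rpow_le_rpow (Nat.cast_nonneg _) hm₁le hβ0) hC₁0.le)
  have h₂ : (tensorRankD (sixTetra F (rectDim n (1 - a)) (rectDim (rectDim n (1 - a)) y)) : ℝ)
      ≤ C₂ * (2 * (n : ℝ) ^ (1 - a)) ^ γ :=
    (hC₂ _ hm₂).trans
      (mul_le_mul_of_nonneg_left (Real.rpow_le_rpow (Nat.cast_nonneg _) hm₂le hγ0) hC₂0.le)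
  have hC₁' : 0 ≤ C₁ * (2 * (n : ℝ) ^ a) ^ β :=
    mul_nonneg hC₁0.le (Real.rpow_nonneg (by positivity) _)
  calc (tensorRankD (sixTetra F n (rectDim n (a * x + (1 - a) * y))) : ℝ)
      ≤ (tensorRankD (sixTetra F (rectDim n a) (rectDim (rectDim n a) x)) : ℝ) *
          (tensorRankD (sixTetra F (rectDim n (1 - a)) (rectDim (rectDim n (1 - a)) y)) : ℝ) := by
        exact_mod_cast hnat
    _ ≤ (C₁ * (2 * (n : ℝ) ^ a) ^ β) * (C₂ * (2 * (n : ℝ) ^ (1 - a)) ^ γ) :=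
        mul_le_mul h₁ h₂ (Nat.cast_nonneg _) hC₁'
    _ = C₁ * C₂ * ((2 : ℝ) ^ β * (2 : ℝ) ^ γ) * (n : ℝ) ^ (a * β + (1 - a) * γ) := by
        rw [Real.mul_rpow zero_le_two (Real.rpow_nonneg hn0.le _),
          Real.mul_rpow zero_le_two (Real.rpow_nonneg hn0.le _), ← Real.rpow_mul hn0.le,
          ← Real.rpow_mul hn0.le, Real.rpow_add hn0]
        ring

/-- **The sixth-edge ladder is convex on `[0,1]`**: `χ(ax + by) ≤ a χ(x) + b χ(y)` — take admissible
`β < χ(x) + ε`, `γ < χ(y) + ε`, use `convexComb_mem_sixAdmissibleExponents` and let `ε → 0`.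
[cite: LottiRomani1983, §2 (p. 174)] -/
theorem omegaSix_convexOn : ConvexOn ℝ (Set.Icc (0 : ℝ) 1) (omegaSix F) := by
  refine ⟨convex_Icc 0 1, fun x hx y hy a b ha hb hab => ?_⟩
  simp only [smul_eq_mul]
  refine le_of_forall_pos_le_add fun ε hε => ?_
  obtain ⟨β, hβ, hβlt⟩ := exists_lt_of_csInf_lt (sixAdmissibleExponents_nonempty F x)
    (lt_add_of_pos_right (omegaSix F x) hε)
  obtain ⟨γ, hγ, hγlt⟩ := exists_lt_of_csInf_lt (sixAdmissibleExponents_nonempty F y)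
    (lt_add_of_pos_right (omegaSix F y) hε)
  have hmem := convexComb_mem_sixAdmissibleExponents F hx.1 hx.2 hy.1 hy.2 ha hb hab hβ hγ
  calc omegaSix F (a * x + b * y) ≤ a * β + b * γ :=
        csInf_le (sixAdmissibleExponents_bddBelow F _) hmem
    _ ≤ a * (omegaSix F x + ε) + b * (omegaSix F y + ε) :=
        add_le_add (mul_le_mul_of_nonneg_left hβlt.le ha) (mul_le_mul_of_nonneg_left hγlt.le hb)
    _ = a * omegaSix F x + b * omegaSix F y + ε := by linear_combination ε * hab

/-- **Three-point form**: for `0 ≤ δ₁ ≤ δ ≤ δ₂ ≤ 1`, `δ₁ < δ₂`,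
`(δ₂ − δ₁)·χ(δ) ≤ (δ₂ − δ)·χ(δ₁) + (δ − δ₁)·χ(δ₂)`. [cite: LottiRomani1983, §2 (p. 174)] -/
theorem omegaSix_three_point {δ₁ δ δ₂ : ℝ} (h₁ : 0 ≤ δ₁) (h₁₂ : δ₁ ≤ δ) (h₂₃ : δ ≤ δ₂)
    (h₂ : δ₂ ≤ 1) (hlt : δ₁ < δ₂) :
    (δ₂ - δ₁) * omegaSix F δ ≤ (δ₂ - δ) * omegaSix F δ₁ + (δ - δ₁) * omegaSix F δ₂ := by
  have hd : 0 < δ₂ - δ₁ := sub_pos.2 hlt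
  have hd' : δ₂ - δ₁ ≠ 0 := hd.ne'
  have hmem₁ : δ₁ ∈ Set.Icc (0 : ℝ) 1 := ⟨h₁, by linarith⟩
  have hmem₂ : δ₂ ∈ Set.Icc (0 : ℝ) 1 := ⟨by linarith, h₂⟩
  have h := (omegaSix_convexOn F).2 hmem₁ hmem₂ (div_nonneg (sub_nonneg.2 h₂₃) hd.le)
    (div_nonneg (sub_nonneg.2 h₁₂) hd.le) (by field_simp; ring)
  have hδ : (δ₂ - δ) / (δ₂ - δ₁) * δ₁ + (δ - δ₁) / (δ₂ - δ₁) * δ₂ = δ := by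
    field_simp
    ring
  simp only [smul_eq_mul] at h
  rw [hδ] at h
  have h' := mul_le_mul_of_nonneg_left h hd.le
  calc (δ₂ - δ₁) * omegaSix F δ
      ≤ (δ₂ - δ₁) * ((δ₂ - δ) / (δ₂ - δ₁) * omegaSix F δ₁ + (δ - δ₁) / (δ₂ - δ₁) * omegaSix F δ₂) := h'
    _ = (δ₂ - δ) * omegaSix F δ₁ + (δ - δ₁) * omegaSix F δ₂ := by
        field_simp

/-- **The chord**: `χ(δ) ≤ (1 − δ)·ω(2,1,2) + δ·ω(K₄)` for `δ ∈ [0,1]` (endpoints `χ(0) = ω(2,1,2)`,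
`χ(1) = ω(K₄)`). It sharpens the block bound `χ(δ) ≤ ω(2,1,2) + δ` exactly by `δ·(1 − (ω(K₄) − ω(2,1,2)))`.
[cite: LottiRomani1983, §2 (p. 174)] -/
theorem omegaSix_le_chord {δ : ℝ} (h0 : 0 ≤ δ) (h1 : δ ≤ 1) :
    omegaSix F δ ≤ (1 - δ) * omegaRect F 2 1 2 + δ * omegaTetra F := by
  rcases eq_or_lt_of_le h1 with rfl | hlt
  · simp [omegaSix_one]
  have h := omegaSix_three_point F le_rfl h0 h1 le_rfl zero_lt_one
  rw [omegaSix_zero, omegaSix_one] at h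
  linarith

end Convexity

/-! ## §3 What convexity does to the leaf: flat steps and interior growth -/

section Leaf

variable (F : Type) [Field F]

/-- **A flat step is a rung**: if `χ(δ₂) ≤ χ(δ₁)` for some `0 ≤ δ₁ < δ₂ ≤ 1` then `χ(δ₂) ≤ ω(2,1,2)`
(a convex non-decreasing function that does not grow on `[δ₁, δ₂]` is constant on `[0, δ₂]`).
[cite: LottiRomani1983, §2 (p. 174)] -/
theorem sixRung_of_flatStep {δ₁ δ₂ : ℝ} (h₁ : 0 ≤ δ₁) (hlt : δ₁ < δ₂) (h₂ : δ₂ ≤ 1)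
    (hflat : omegaSix F δ₂ ≤ omegaSix F δ₁) : omegaSix F δ₂ ≤ omegaRect F 2 1 2 := by
  rcases eq_or_lt_of_le h₁ with h0 | hpos
  · rw [← h0, omegaSix_zero] at hflat
    exact hflat
  have h := omegaSix_three_point F le_rfl h₁ hlt.le h₂ (h₁.trans_lt hlt)
  rw [omegaSix_zero, sub_zero, sub_zero] at h
  have hd : 0 < δ₂ - δ₁ := sub_pos.2 hlt
  have hm := mul_le_mul_of_nonneg_left hflat hpos.le
  have key : (δ₂ - δ₁) * omegaSix F δ₁ ≤ (δ₂ - δ₁) * omegaRect F 2 1 2 := by linarith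
  exact hflat.trans (le_of_mul_le_mul_left key hd)

/-- **Growth at one interior point is the whole leaf**: `ω(K₄) ≤ χ(δ₀)` for a single `δ₀ < 1`
forces `ω(K₄) ≤ ω(2,1,2)` (the step `[δ₀, 1]` is flat). In particular any statement of the shape
«`χ` has already reached `ω(K₄)` at `δ₀ < 1`» is EQUIVALENT to `TetraExcessZero`, not weaker.
[cite: LottiRomani1983, §2 (p. 174)] -/
theorem excessZero_of_omegaTetra_le_omegaSix {δ₀ : ℝ} (h1 : δ₀ < 1)
    (h : omegaTetra F ≤ omegaSix F δ₀) : omegaTetra F ≤ omegaRect F 2 1 2 := by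
  by_cases h0 : δ₀ < 0
  · exact h.trans ((omegaSix_mono F h0.le).trans (omegaSix_zero F).le)
  rw [not_lt] at h0
  have hflat : omegaSix F 1 ≤ omegaSix F δ₀ := by
    rw [omegaSix_one]
    exact h
  have hr := sixRung_of_flatStep F h0 h1 le_rfl hflat
  rwa [omegaSix_one] at hr

/-- `ω(K₄) ≤ χ(δ₀) ⟺ ω(K₄) ≤ ω(2,1,2)` for every `δ₀ < 1`. [cite: LottiRomani1983, §2 (p. 174)] -/
theorem omegaTetra_le_omegaSix_iff_excessZero {δ₀ : ℝ} (h1 : δ₀ < 1) :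
    omegaTetra F ≤ omegaSix F δ₀ ↔ omegaTetra F ≤ omegaRect F 2 1 2 :=
  ⟨excessZero_of_omegaTetra_le_omegaSix F h1,
    fun hE => hE.trans (omegaRect_two_one_two_le_omegaSix F δ₀)⟩

/-- **Self-correction of the «half-edge» skeleton (generation 23)**: its stub
`stub_growHalf : ω(K₄) ≤ χ(1/2)` is equivalent to the crux `TetraExcessZero` itself (so that line was
the crux plus a decoration, and is withdrawn). [cite: LottiRomani1983, §2 (p. 174)] -/
theorem growHalf_iff_tetraExcessZero :
    omegaTetra ℂ ≤ omegaSix ℂ (1 / 2) ↔ TetraExcessZero :=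
  omegaTetra_le_omegaSix_iff_excessZero ℂ (by norm_num)

/-- The leaf as the flatness of the LAST step: `TetraExcessZero ⟺ ∃ δ < 1, χ(1) ≤ χ(δ)`. -/
theorem excessZero_iff_exists_flatTop :
    omegaTetra F ≤ omegaRect F 2 1 2 ↔ ∃ δ : ℝ, δ < 1 ∧ omegaTetra F ≤ omegaSix F δ :=
  ⟨fun hE => ⟨0, zero_lt_one, hE.trans (omegaSix_zero F).ge⟩,
    fun ⟨_, hδ1, h⟩ => excessZero_of_omegaTetra_le_omegaSix F hδ1 h⟩

end Leaf

/-! ## §4 The reshaped line «rung-and-chord»: `TetraExcessZero ⟺ SixRungPos ∧ MidTight` -/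

section Line

variable (F : Type) [Field F]

/-- **MidTight ⟹ NoKink**: if the ladder touches its chord at the midpoint
(`ω(2,1,2) + ω(K₄) ≤ 2χ(1/2)`) then it IS the chord: `(1−δ)·ω(2,1,2) + δ·ω(K₄) ≤ χ(δ)` on `[0,1]`
(convexity transported from the midpoint to `δ` through the endpoint on the far side).
[cite: LottiRomani1983, §2 (p. 174)] -/
theorem noKink_of_midTight (hmid : omegaRect F 2 1 2 + omegaTetra F ≤ 2 * omegaSix F (1 / 2))
    {δ : ℝ} (h0 : 0 ≤ δ) (h1 : δ ≤ 1) :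
    (1 - δ) * omegaRect F 2 1 2 + δ * omegaTetra F ≤ omegaSix F δ := by
  by_cases hδ : δ ≤ 1 / 2
  · -- `1/2 ∈ [δ, 1]`
    have h := omegaSix_three_point F h0 hδ (by norm_num : (1 / 2 : ℝ) ≤ 1) le_rfl
      (lt_of_le_of_lt hδ (by norm_num))
    rw [omegaSix_one] at h
    have hA := mul_le_mul_of_nonneg_left hmid (sub_nonneg.2 h1)
    linarith
  · -- `1/2 ∈ [0, δ]`
    rw [not_le] at hδ
    have h := omegaSix_three_point F le_rfl (by norm_num : (0 : ℝ) ≤ 1 / 2) hδ.le h1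
      (lt_trans (by norm_num) hδ)
    rw [omegaSix_zero, sub_zero, sub_zero] at h
    have hA := mul_le_mul_of_nonneg_left hmid h0
    linarith

/-- **MidTight ⟺ NoKink.** [cite: LottiRomani1983, §2 (p. 174)] -/
theorem midTight_iff_noKink :
    omegaRect F 2 1 2 + omegaTetra F ≤ 2 * omegaSix F (1 / 2) ↔
      ∀ δ : ℝ, 0 ≤ δ → δ ≤ 1 → (1 - δ) * omegaRect F 2 1 2 + δ * omegaTetra F ≤ omegaSix F δ := by
  refine ⟨fun hmid δ h0 h1 => noKink_of_midTight F hmid h0 h1, fun h => ?_⟩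
  have := h (1 / 2) (by norm_num) (by norm_num)
  linarith

/-- **The glue of the reshaped line**: one rung above the bottom (`∃ δ > 0, χ(δ) ≤ ω(2,1,2)`) and
midpoint tightness (`ω(2,1,2) + ω(K₄) ≤ 2χ(1/2)`) give the leaf `ω(K₄) ≤ ω(2,1,2)`: the rung makes
`χ` vanish to first order at `0`, tightness makes `χ` the chord, whose slope `ω(K₄) − ω(2,1,2)` is
therefore `≤ 0`. [cite: LottiRomani1983, §2 (p. 174)] -/
theorem excessZero_of_sixRungPos_of_midTight
    (hr : ∃ δ : ℝ, 0 < δ ∧ omegaSix F δ ≤ omegaRect F 2 1 2)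
    (hmid : omegaRect F 2 1 2 + omegaTetra F ≤ 2 * omegaSix F (1 / 2)) :
    omegaTetra F ≤ omegaRect F 2 1 2 := by
  obtain ⟨δ₀, hδ₀, hr⟩ := hr
  have hk := noKink_of_midTight F hmid (le_min hδ₀.le zero_le_one) (min_le_right δ₀ 1)
  have hr' : omegaSix F (min δ₀ 1) ≤ omegaRect F 2 1 2 := (omegaSix_mono F (min_le_left _ _)).trans hr
  have hm : 0 < min δ₀ 1 := lt_min hδ₀ zero_lt_one
  have key : min δ₀ 1 * omegaTetra F ≤ min δ₀ 1 * omegaRect F 2 1 2 := by linarith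
  exact le_of_mul_le_mul_left key hm

/-- **The leaf is exactly the two pieces**: `ω(K₄) ≤ ω(2,1,2) ⟺ SixRungPos ∧ MidTight`.
[cite: LottiRomani1983, §2 (p. 174)] -/
theorem excessZero_iff_sixRungPos_and_midTight :
    omegaTetra F ≤ omegaRect F 2 1 2 ↔
      (∃ δ : ℝ, 0 < δ ∧ omegaSix F δ ≤ omegaRect F 2 1 2) ∧
        omegaRect F 2 1 2 + omegaTetra F ≤ 2 * omegaSix F (1 / 2) := by
  refine ⟨fun hE => ⟨⟨1, zero_lt_one, ?_⟩, ?_⟩,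
    fun h => excessZero_of_sixRungPos_of_midTight F h.1 h.2⟩
  · rw [omegaSix_one]
    exact hE
  · linarith [omegaRect_two_one_two_le_omegaSix F (1 / 2)]

/-- **SixRungPos ⟹ FirstOrderFree** (`∀ ε > 0 ∃ δ ∈ (0,1], χ(δ) ≤ ω(2,1,2) + εδ`): a rung is much
more than first-order vanishing. -/
theorem firstOrderFree_of_sixRungPos (hr : ∃ δ : ℝ, 0 < δ ∧ omegaSix F δ ≤ omegaRect F 2 1 2)
    {ε : ℝ} (hε : 0 < ε) :
    ∃ δ : ℝ, 0 < δ ∧ δ ≤ 1 ∧ omegaSix F δ ≤ omegaRect F 2 1 2 + ε * δ := by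
  obtain ⟨δ₀, hδ₀, hr⟩ := hr
  refine ⟨min δ₀ 1, lt_min hδ₀ zero_lt_one, min_le_right _ _, ?_⟩
  have hr' : omegaSix F (min δ₀ 1) ≤ omegaRect F 2 1 2 := (omegaSix_mono F (min_le_left _ _)).trans hr
  nlinarith [lt_min hδ₀ zero_lt_one]

/-- **FirstOrderFree ∧ NoKink ⟹ the leaf**: if `χ` vanishes to first order at `0` and lies on or
above its chord, the chord has slope `≤ 0`. This is the weakest rung-side hypothesis the chord
argument accepts. [cite: LottiRomani1983, §2 (p. 174)] -/
theorem excessZero_of_firstOrderFree_of_noKink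
    (hfree : ∀ ε : ℝ, 0 < ε → ∃ δ : ℝ, 0 < δ ∧ δ ≤ 1 ∧ omegaSix F δ ≤ omegaRect F 2 1 2 + ε * δ)
    (hkink : ∀ δ : ℝ, 0 ≤ δ → δ ≤ 1 →
      (1 - δ) * omegaRect F 2 1 2 + δ * omegaTetra F ≤ omegaSix F δ) :
    omegaTetra F ≤ omegaRect F 2 1 2 := by
  by_contra hne
  rw [not_le] at hne
  obtain ⟨δ, hδ0, hδ1, hδ⟩ := hfree ((omegaTetra F - omegaRect F 2 1 2) / 2) (by linarith)
  have hk := hkink δ hδ0.le hδ1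
  have key : δ * (omegaTetra F - omegaRect F 2 1 2) ≤ δ * ((omegaTetra F - omegaRect F 2 1 2) / 2) := by
    linarith
  have := le_of_mul_le_mul_left key hδ0
  linarith

/-- Both pieces are NECESSARY (`ω = 2 ⟹` each): under `ω = 2` the ladder is identically `4`. -/
theorem sixRungPos_and_midTight_of_matrixMultiplication (hS : _root_.MatrixMultiplication) :
    (∃ δ : ℝ, 0 < δ ∧ omegaSix ℂ δ ≤ omegaRect ℂ 2 1 2) ∧
      omegaRect ℂ 2 1 2 + omegaTetra ℂ ≤ 2 * omegaSix ℂ (1 / 2) :=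
  (excessZero_iff_sixRungPos_and_midTight ℂ).1 (excessZero_of_matrixMultiplication hS)

/-- **The reshaped line decides the crux** (over `ℂ`, by name):
`SixRungPos → MidTight → TetraExcessZero`. [cite: LottiRomani1983, §2 (p. 174)] -/
theorem tetraExcessZero_of_sixRungPos_of_midTight
    (hr : ∃ δ : ℝ, 0 < δ ∧ omegaSix ℂ δ ≤ omegaRect ℂ 2 1 2)
    (hmid : omegaRect ℂ 2 1 2 + omegaTetra ℂ ≤ 2 * omegaSix ℂ (1 / 2)) : TetraExcessZero :=
  excessZero_of_sixRungPos_of_midTight ℂ hr hmid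

/-- … and conversely `TetraExcessZero ⟺ SixRungPos ∧ MidTight`. -/
theorem tetraExcessZero_iff_sixRungPos_and_midTight :
    TetraExcessZero ↔
      (∃ δ : ℝ, 0 < δ ∧ omegaSix ℂ δ ≤ omegaRect ℂ 2 1 2) ∧
        omegaRect ℂ 2 1 2 + omegaTetra ℂ ≤ 2 * omegaSix ℂ (1 / 2) :=
  excessZero_iff_sixRungPos_and_midTight ℂ

/-- **The summit through the reshaped line**: `ω = 2 ⟺ SixRungPos ∧ MidTight ∧ TetraPlusTwo`
(the route's cut `closes (hA : TetraExcessZero) (hB : TetraPlusTwo)` with `hA` split). -/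
theorem matrixMultiplication_iff_sixRungPos_midTight_plusTwo :
    _root_.MatrixMultiplication ↔
      ((∃ δ : ℝ, 0 < δ ∧ omegaSix ℂ δ ≤ omegaRect ℂ 2 1 2) ∧
        omegaRect ℂ 2 1 2 + omegaTetra ℂ ≤ 2 * omegaSix ℂ (1 / 2)) ∧ TetraPlusTwo := by
  rw [← excessZero_iff_sixRungPos_and_midTight ℂ]
  exact matrixMultiplication_iff_excessZero_and_plusTwo'

end Line

end Summit.MatrixMultiplication.MatrixMultiplication.Theorems.EdgePencil

end
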